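import Summits.BirchSwinnertonDyer.BirchSwinnertonDyer.Theorems.ByReductionTypeAtTwoRankOneAtTwoOffBigImageOddLocalEngineLocalTriviality
import HarnessLib

/-!
# Route `ByReductionTypeAtTwo`, crux `RankOneAtTwoOffBigImageOddLocal` (stmt-BirchSwinnertonDyer-23716), line
# `refined_kolyvagin_tamagawa_shift_at_two` — ENGINE PORT `c₀ ↦ h₀` (regular element): §J′ ANTI-LOSSLESS `Ĥ⁻¹ = 0`, §N′ the regular Frobenius clause at a PRESCRIBED prime above `ℓ`, §N″ Galois-level anti-lossless

Lead prover `prover-cruxlead-stmt-BirchSwinnertonDyer-23716-g2` (2026-08-28, KEEP-by-lineage successor of `…-g0`), landing the parts of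
the crux-plan g6 ENGINE QUARRY published after the g0 lead's last landing: the main quarry
`Cruxes/RankOneAtTwoOffBigImageOddLocal/RefinedKolyvaginEngineG6.lean` v13 (§J′, commit cc0324ebb880) and the annex
`Cruxes/RankOneAtTwoOffBigImageOddLocal/RefinedKolyvaginEngineG6LocalN.lean` v2/v3 (§N′, §N″; commit of 17:42Z), planner
`cruxplan-…-23716-refined-kolyvag-9ff2fe475f-g6`, both rc 0 / 0 sorry.  `Cruxes/` files are not importable, so the lead COPIES the proofs
into `Theorems/` as `--supports stmt-BirchSwinnertonDyer-23716` helpers, continuing the chain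
`…Engine{Dictionary,Parity,Cyclotomic,CyclotomicBasis,GoursatLift,Chebotarev,RegularSupply,RegularLift,StepB,RamifiedSupply,RegularInvolution,
ImageTokens,EndToEnd,StubVocabulary,LocalTriviality}.lean` (namespace `…Theorems.OffBigImageOddLocalAtTwo.Engine`).

THIS FILE.
* §J′ — **anti-lossless at module level**: for the regular involution `reg b = [[1,1],[0,-1]]` of a rank-`2` free `ZMod q`-module,
  `ker(reg + 1) = im(reg - 1)` on the `c`-torsion for every integer `c` (`repr_one_eq_of_reg_eq_neg`, `eq_of_reg_eq_neg`,
  `exists_eq_sub_reg_of_reg_eq_neg`).  With §J's LOSSLESS `exists_eq_add_reg_of_reg_eq` (`Ĥ⁰ = 0`): the regular involution is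
  cohomologically trivial on every `T[2^e]`, whereas `diag(1,-1)` (complex conjugation at `Δ > 0`) has `Ĥ⁰ ≅ Ĥ⁻¹ ≅ (ℤ/2)²` on `(ℤ/2^M)²` —
  the factor-`2` loss of Gross's argument at `p = 2` (McCallum §5) that the regular filter is designed to avoid.
* §N′ — **the regular Frobenius clause at EVERY prime `𝔓 ∣ ℓ`** (regular analogue of the tree's `FrobEqFrobInfty.exists_at`, Gross (3.2) as a
  conjugacy-class statement): `exists_conj_mul_absGaloisRestrict_eq` (`γ (c₀ · res ρ) γ⁻¹ = (γ c₀ γ⁻¹) · res ρ'`, normality of `res Γ_K ⊴ Γ_ℚ`),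
  `regularFrob_exists_at`, `conj_clauses` (the involution / `μ_m`-inversion / `2^n`-witness / lossless clauses transfer along `P ↦ γ • P`),
  and the packaged `regularKolyvaginPrime_at`: from the output clauses of `Engine.exists_regular_kolyvaginPrime_of_heegner` and ANY `𝔓 ∣ ℓ`,
  a complex conjugation `c₀'`, `ρ' ∈ Γ_K` and an arithmetic Frobenius `h` AT `𝔓` with `h = c₀' · res ρ'` on `E[m]`, `h = c₀'` on `K`, and all
  four clauses for `c₀' · res ρ'`.
* §N″ — **Galois-level anti-lossless** derived from the exported lossless clause by counting (`antiLossless_of_lossless`: for an additive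
  involution `A` of a finite abelian group, `ker(A-1) ⊆ im(A+1) ⇒ ker(A+1) ⊆ im(A-1)`, since `|im(A±1)|·|ker(A±1)| = |T|`), packaged as
  `antiLossless_geomTorsion` for any `h₀ ∈ Γ_ℚ` with §K's `hsq` + `hker` — the clause the `(ε = -1)`-eigen-consumers of card E4 group (γ)
  (McCallum's `τ = -1` part) take, with no change to §J → §H → §K.

Statements and proofs are the quarry's VERBATIM (namespace moved to `…Theorems.OffBigImageOddLocalAtTwo.Engine`).  Nothing here proves the
crux, `BSDp W 2`, BSD or the summit; no registered stub is discharged (engine inputs only).  BSD is not proved.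

Refs: [GrossLMS1991] §3 (3.1)–(3.2), §9; [McCallumLMS1991] §4, §5; [NeukirchANT1999] I (8.2), II (9.6); [SilvermanAEC2009] VII.4.1, VII.5.1.
-/

set_option linter.dupNamespace false -- tree convention: `Summit.BirchSwinnertonDyer.BirchSwinnertonDyer.Theorems` (summit = sub-problem)
set_option autoImplicit false

noncomputable section

namespace Summit.BirchSwinnertonDyer.BirchSwinnertonDyer.Theorems.OffBigImageOddLocalAtTwo.Engine

open scoped Classical Pointwise
open _root_.WeierstrassCurve NumberField IsDedekindDomain Field Function
open Literature.NumberTheory.GaloisRepresentations Literature.NumberTheory.EllipticCurves Literature.NumberTheory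

/-! ## §J′  ANTI-LOSSLESS for the regular involution `[[1,1],[0,-1]]`: `ker(reg + 1) = im(reg - 1)` on every `T[c]` -/

section RegularInvolutionAnti

variable {q : ℕ} {T : Type*} [AddCommGroup T] [Module (ZMod q) T] (b : Module.Basis (Fin 2) (ZMod q) T)

/-- A `reg`-ANTI-invariant vector: `(x + y, -y) = (-x, -y) ⟹ y = -2x`, so `X = x•b₀ - 2x•b₁`. [folklore] -/
theorem repr_one_eq_of_reg_eq_neg {X : T} (h : reg b X = -X) : b.repr X 1 = -(2 * b.repr X 0) := by
  have h0 := congrArg (fun Z ↦ b.repr Z 0) h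
  simp only [repr_reg_zero, map_neg, Finsupp.coe_neg, Pi.neg_apply] at h0
  linear_combination h0

/-- Normal form of a `reg`-anti-invariant vector: `X = x•b₀ - 2x•b₁` with `x = b.repr X 0`. [folklore] -/
theorem eq_of_reg_eq_neg {X : T} (h : reg b X = -X) : X = b.repr X 0 • b 0 - (2 * b.repr X 0) • b 1 := by
  have h1 := repr_one_eq_of_reg_eq_neg b h
  refine b.ext_elem fun i ↦ ?_
  fin_cases i <;> simp [h1]

/-- **ANTI-LOSSLESS — `Ĥ⁻¹(⟨reg⟩, T[c]) = 0`**: `ker(reg + 1) = im(reg - 1)` on the `c`-torsion of `T` for every integer `c`: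
an anti-invariant `X` with `cX = 0` is `Y - reg Y` for `Y = -x•b₁`, and `cY = 0`.  (Companion of the LOSSLESS lemma
`exists_eq_add_reg_of_reg_eq`, `Ĥ⁰ = 0`; together: the regular involution is COHOMOLOGICALLY TRIVIAL on every `T[2^e]`,
whereas `diag(1,-1)` has `Ĥ⁰ ≅ Ĥ⁻¹ ≅ (ℤ/2)²` on `(ℤ/2^M)²` — the factor-`2` loss of Gross's argument at `p = 2`.) [folklore] -/
theorem exists_eq_sub_reg_of_reg_eq_neg {c : ℤ} {X : T} (hc : c • X = 0) (h : reg b X = -X) :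
    ∃ Y : T, c • Y = 0 ∧ X = Y - reg b Y := by
  have hX := eq_of_reg_eq_neg b h
  set x := b.repr X 0 with hx
  have hcx : ((c : ZMod q) * x) = 0 := by
    have h0 := congrArg (fun Z ↦ b.repr Z 0) hc
    rw [hX, ← Int.cast_smul_eq_zsmul (ZMod q), smul_sub, smul_smul, smul_smul] at h0
    simpa [Finsupp.single_apply] using h0
  refine ⟨-(x • b 1), ?_, ?_⟩
  · rw [smul_neg, ← Int.cast_smul_eq_zsmul (ZMod q), smul_smul, hcx, zero_smul, neg_zero]
  · rw [hX]
    refine b.ext_elem fun i ↦ ?_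
    fin_cases i
    · simp [reg]
    · simp [reg]; ring

end RegularInvolutionAnti

/-! ## §N′  THE REGULAR FROBENIUS CLAUSE AT EVERY PRIME ABOVE `ℓ` (regular `FrobEqFrobInfty.exists_at`, PROVED)

Gross's (3.2) is a statement about a conjugacy class; so is the regular clause: conjugating `h`, `c₀` AND `ρ` simultaneously by `γ ∈ Γ_ℚ`
with `γ 𝔓₀ = 𝔓` moves the Frobenius to any prescribed `𝔓 ∣ ℓ`, replaces `c₀` by the complex conjugation `γ c₀ γ⁻¹` and `ρ` by some
`ρ' ∈ Γ_K` (`res Γ_K ⊴ Γ_ℚ`), and the four `E[m]` / `μ_m` clauses of §J/§K transfer along `P ↦ γ • P`.  (Consumers that fixed ONE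
global `c₀` for the `τ`-eigenspace decomposition are unaffected: `conjAct` is lift-independent, `IsLiftOfAut.conjH1_eq_conjAct`.) -/

section PrescribedPrimeN

universe u'

variable (W : WeierstrassCurve ℚ) {K : Type u'} [Field K] [NumberField K]

/-- Conjugation inside `Γ_ℚ` of an element of the form `c₀ · res ρ` (`ρ ∈ Γ_K`) is again of that form, with the conjugate `c₀`:
`γ (c₀ · res ρ) γ⁻¹ = (γ c₀ γ⁻¹) · res ρ'` (normality of `res Γ_K ⊴ Γ_ℚ`, index `2`). -/
theorem exists_conj_mul_absGaloisRestrict_eq (hK : IsImaginaryQuadratic K) (c₀ γ : absoluteGaloisGroup ℚ)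
    (ρ : absoluteGaloisGroup K) :
    ∃ ρ' : absoluteGaloisGroup K, γ * (c₀ * absGaloisRestrict ℚ K ρ) * γ⁻¹ = (γ * c₀ * γ⁻¹) * absGaloisRestrict ℚ K ρ' := by
  haveI : Algebra.IsQuadraticExtension ℚ K := ⟨hK.1⟩
  have hHi := index_range_absGaloisRestrict_eq_finrank ℚ K
  haveI hHn : ((absGaloisRestrict ℚ K).range).Normal :=
    Subgroup.normal_of_index_eq_two (hHi.trans hK.1)
  obtain ⟨ρ', hρ'⟩ : γ * absGaloisRestrict ℚ K ρ * γ⁻¹ ∈ (absGaloisRestrict ℚ K).range :=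
    hHn.conj_mem _ ⟨ρ, rfl⟩ γ
  refine ⟨ρ', ?_⟩
  have hρ'' : absGaloisRestrict ℚ K ρ' = γ * absGaloisRestrict ℚ K ρ * γ⁻¹ := hρ'
  rw [hρ'']; group

/-- **The regular Frobenius clause holds at EVERY prime above `ℓ`** (regular analogue of `FrobEqFrobInfty.exists_at`, Gross (3.2)):
conjugate `h`, `c₀` and `ρ` simultaneously by `γ ∈ Γ_ℚ` with `γ 𝔓₀ = 𝔓`.  The complex conjugation changes to its conjugate
`γ c₀ γ⁻¹` (still a complex conjugation, `IsComplexConjugation.conj_mul`) and `ρ` to some `ρ' ∈ Γ_K`; the involution / `μ`-inversion /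
lossless clauses transfer along `P ↦ γ • P` (`conj_clauses` below). -/
theorem regularFrob_exists_at [W.IsElliptic] (hK : IsImaginaryQuadratic K) {m : ℕ}
    {c₀ : absoluteGaloisGroup ℚ} (hc₀ : IsComplexConjugation (Rat.castHom ℝ) c₀) {ρ : absoluteGaloisGroup K}
    {ℓ : ℕ} (hℓ : ℓ.Prime)
    (hfrob : ∃ (v : HeightOneSpectrum (𝓞 ℚ)) (𝔓 : Ideal (absIntegers (𝓞 ℚ) ℚ)) (h : absoluteGaloisGroup ℚ),
      (ℓ : 𝓞 ℚ) ∈ v.asIdeal ∧ 𝔓 ∈ v.primesAbove ∧ IsArithFrobAt (𝓞 ℚ) h 𝔓 ∧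
      (∀ P : geomTorsion W (m : ℤ), h • P = (c₀ * absGaloisRestrict ℚ K ρ) • P) ∧
      ∀ (e : K →ₐ[ℚ] AlgebraicClosure ℚ) (x : K), h • e x = c₀ • e x)
    {v : HeightOneSpectrum (𝓞 ℚ)} (hℓv : (ℓ : 𝓞 ℚ) ∈ v.asIdeal)
    {𝔓 : Ideal (absIntegers (𝓞 ℚ) ℚ)} (h𝔓 : 𝔓 ∈ v.primesAbove) :
    ∃ (γ h : absoluteGaloisGroup ℚ) (ρ' : absoluteGaloisGroup K), IsArithFrobAt (𝓞 ℚ) h 𝔓 ∧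
      IsComplexConjugation (Rat.castHom ℝ) (γ * c₀ * γ⁻¹) ∧
      γ * (c₀ * absGaloisRestrict ℚ K ρ) * γ⁻¹ = (γ * c₀ * γ⁻¹) * absGaloisRestrict ℚ K ρ' ∧
      (∀ P : geomTorsion W (m : ℤ), h • P = ((γ * c₀ * γ⁻¹) * absGaloisRestrict ℚ K ρ') • P) ∧
      ∀ (e : K →ₐ[ℚ] AlgebraicClosure ℚ) (x : K), h • e x = (γ * c₀ * γ⁻¹) • e x := by
  obtain ⟨v₀, 𝔓₀, h, hℓv₀, h𝔓₀, hFrob, hhP, hhK⟩ := hfrob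
  have hv : v₀ = v := HeightOneSpectrum.eq_of_natCast_mem_rat hℓ hℓv₀ hℓv
  subst hv
  obtain ⟨γ, -, hFrob'⟩ :=
    HeightOneSpectrum.exists_isArithFrobAt_conj_of_mem_primesAbove_holds h𝔓₀ h𝔓 hFrob
  obtain ⟨ρ', hρ'⟩ := exists_conj_mul_absGaloisRestrict_eq hK c₀ γ ρ
  refine ⟨γ, γ * h * γ⁻¹, ρ', hFrob', hc₀.conj_mul γ, hρ', fun P ↦ ?_, fun e x ↦ ?_⟩
  · rw [← hρ', mul_smul, mul_smul, hhP, ← mul_smul, ← mul_smul]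
  · set e' : K →ₐ[ℚ] AlgebraicClosure ℚ :=
      ((show AlgebraicClosure ℚ ≃ₐ[ℚ] AlgebraicClosure ℚ from γ⁻¹) :
        AlgebraicClosure ℚ →ₐ[ℚ] AlgebraicClosure ℚ).comp e with he'
    have hx : γ⁻¹ • e x = e' x := rfl
    rw [mul_smul, mul_smul, hx, hhK e', ← hx, ← mul_smul, ← mul_smul]

/-- Transfer of the three `E[m]`-clauses (involution, a lossless-type witness, lossless) and the `μ_m`-inversion along conjugation by `γ`. -/
theorem conj_clauses [W.IsElliptic] {m n : ℕ} (h₀ γ : absoluteGaloisGroup ℚ)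
    (hsq : ∀ P : geomTorsion W (m : ℤ), h₀ • h₀ • P = P)
    (hμ : ∀ ζ : AlgebraicClosure ℚ, ζ ^ m = 1 → h₀ • ζ = ζ⁻¹)
    (hP1 : ∃ P : geomTorsion W (m : ℤ), (2 : ℤ) ^ n • (P + h₀ • P) ≠ 0)
    (hker : ∀ (k : ℕ) (X : geomTorsion W (m : ℤ)), (2 : ℤ) ^ k • X = 0 → h₀ • X = X →
      ∃ Y : geomTorsion W (m : ℤ), (2 : ℤ) ^ k • Y = 0 ∧ X = Y + h₀ • Y) :
    (∀ P : geomTorsion W (m : ℤ), (γ * h₀ * γ⁻¹) • (γ * h₀ * γ⁻¹) • P = P) ∧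
    (∀ ζ : AlgebraicClosure ℚ, ζ ^ m = 1 → (γ * h₀ * γ⁻¹) • ζ = ζ⁻¹) ∧
    (∃ P : geomTorsion W (m : ℤ), (2 : ℤ) ^ n • (P + (γ * h₀ * γ⁻¹) • P) ≠ 0) ∧
    (∀ (k : ℕ) (X : geomTorsion W (m : ℤ)), (2 : ℤ) ^ k • X = 0 → (γ * h₀ * γ⁻¹) • X = X →
      ∃ Y : geomTorsion W (m : ℤ), (2 : ℤ) ^ k • Y = 0 ∧ X = Y + (γ * h₀ * γ⁻¹) • Y) := by
  have hconj : ∀ Z : geomTorsion W (m : ℤ), (γ * h₀ * γ⁻¹) • γ • Z = γ • h₀ • Z := fun Z ↦ by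
    rw [mul_smul, mul_smul, inv_smul_smul]
  refine ⟨fun P ↦ ?_, fun ζ hζ ↦ ?_, ?_, fun k X hk hX ↦ ?_⟩
  · rw [mul_smul, mul_smul, mul_smul, mul_smul, inv_smul_smul, hsq, smul_inv_smul]
  · have hζ' : (γ⁻¹ • ζ) ^ m = 1 := by rw [← smul_pow', hζ, smul_one]
    rw [mul_smul, mul_smul, hμ _ hζ', smul_inv'', smul_inv_smul]
  · obtain ⟨P, hP⟩ := hP1
    refine ⟨γ • P, fun h0 ↦ hP ?_⟩
    rw [hconj, ← smul_add, smul_comm ((2 : ℤ) ^ n) γ, smul_eq_zero_iff_eq] at h0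
    exact h0
  · have hk' : (2 : ℤ) ^ k • γ⁻¹ • X = 0 := by rw [smul_comm, hk, smul_zero]
    have h1 : h₀ • γ⁻¹ • X = γ⁻¹ • X := by
      conv_rhs => rw [← hX]
      rw [mul_smul, mul_smul, inv_smul_smul]
    obtain ⟨Y, hY, hXY⟩ := hker k (γ⁻¹ • X) hk' h1
    refine ⟨γ • Y, by rw [smul_comm, hY, smul_zero], ?_⟩
    rw [hconj, ← smul_add, ← hXY, smul_inv_smul]

/-- **PACKAGED: the §K data at a PRESCRIBED prime `𝔓 ∣ ℓ` of `\bar ℤ`.**  From the clauses of `exists_regular_kolyvaginPrime_of_heegner` for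
`h₀ = c₀ · res ρ` (involution on `E[m]`, `μ_m`-inversion, the `2^n`-witness, lossless) and its Frobenius clause at SOME prime above `ℓ`, obtain —
at ANY `𝔓 ∣ ℓ` — a complex conjugation `c₀'`, `ρ' ∈ Γ_K` and an arithmetic Frobenius `h` AT `𝔓` with `h = c₀' · res ρ'` on `E[m]`, `h = c₀'` on `K`,
and all four clauses for `c₀' · res ρ'`. -/
theorem regularKolyvaginPrime_at [W.IsElliptic] (hK : IsImaginaryQuadratic K) {m n : ℕ}
    {c₀ : absoluteGaloisGroup ℚ} (hc₀ : IsComplexConjugation (Rat.castHom ℝ) c₀) {ρ : absoluteGaloisGroup K}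
    (hsq : ∀ P : geomTorsion W (m : ℤ), (c₀ * absGaloisRestrict ℚ K ρ) • (c₀ * absGaloisRestrict ℚ K ρ) • P = P)
    (hμ : ∀ ζ : AlgebraicClosure ℚ, ζ ^ m = 1 → (c₀ * absGaloisRestrict ℚ K ρ) • ζ = ζ⁻¹)
    (hP1 : ∃ P : geomTorsion W (m : ℤ), (2 : ℤ) ^ n • (P + (c₀ * absGaloisRestrict ℚ K ρ) • P) ≠ 0)
    (hker : ∀ (k : ℕ) (X : geomTorsion W (m : ℤ)), (2 : ℤ) ^ k • X = 0 → (c₀ * absGaloisRestrict ℚ K ρ) • X = X →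
      ∃ Y : geomTorsion W (m : ℤ), (2 : ℤ) ^ k • Y = 0 ∧ X = Y + (c₀ * absGaloisRestrict ℚ K ρ) • Y)
    {ℓ : ℕ} (hℓ : ℓ.Prime)
    (hfrob : ∃ (v : HeightOneSpectrum (𝓞 ℚ)) (𝔓 : Ideal (absIntegers (𝓞 ℚ) ℚ)) (h : absoluteGaloisGroup ℚ),
      (ℓ : 𝓞 ℚ) ∈ v.asIdeal ∧ 𝔓 ∈ v.primesAbove ∧ IsArithFrobAt (𝓞 ℚ) h 𝔓 ∧
      (∀ P : geomTorsion W (m : ℤ), h • P = (c₀ * absGaloisRestrict ℚ K ρ) • P) ∧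
      ∀ (e : K →ₐ[ℚ] AlgebraicClosure ℚ) (x : K), h • e x = c₀ • e x)
    {v : HeightOneSpectrum (𝓞 ℚ)} (hℓv : (ℓ : 𝓞 ℚ) ∈ v.asIdeal)
    {𝔓 : Ideal (absIntegers (𝓞 ℚ) ℚ)} (h𝔓 : 𝔓 ∈ v.primesAbove) :
    ∃ (c₀' h : absoluteGaloisGroup ℚ) (ρ' : absoluteGaloisGroup K),
      IsComplexConjugation (Rat.castHom ℝ) c₀' ∧ IsArithFrobAt (𝓞 ℚ) h 𝔓 ∧
      (∀ P : geomTorsion W (m : ℤ), h • P = (c₀' * absGaloisRestrict ℚ K ρ') • P) ∧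
      (∀ (e : K →ₐ[ℚ] AlgebraicClosure ℚ) (x : K), h • e x = c₀' • e x) ∧
      (∀ P : geomTorsion W (m : ℤ), (c₀' * absGaloisRestrict ℚ K ρ') • (c₀' * absGaloisRestrict ℚ K ρ') • P = P) ∧
      (∀ ζ : AlgebraicClosure ℚ, ζ ^ m = 1 → (c₀' * absGaloisRestrict ℚ K ρ') • ζ = ζ⁻¹) ∧
      (∃ P : geomTorsion W (m : ℤ), (2 : ℤ) ^ n • (P + (c₀' * absGaloisRestrict ℚ K ρ') • P) ≠ 0) ∧
      (∀ (k : ℕ) (X : geomTorsion W (m : ℤ)), (2 : ℤ) ^ k • X = 0 → (c₀' * absGaloisRestrict ℚ K ρ') • X = X →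
        ∃ Y : geomTorsion W (m : ℤ), (2 : ℤ) ^ k • Y = 0 ∧ X = Y + (c₀' * absGaloisRestrict ℚ K ρ') • Y) := by
  obtain ⟨γ, h, ρ', hFrob, hc₀', hρ', hhP, hhK⟩ := regularFrob_exists_at W hK hc₀ hℓ hfrob hℓv h𝔓
  obtain ⟨h1, h2, h3, h4⟩ := conj_clauses W (n := n) (c₀ * absGaloisRestrict ℚ K ρ) γ hsq hμ hP1 hker
  rw [hρ'] at h1 h2 h3 h4
  exact ⟨γ * c₀ * γ⁻¹, h, ρ', hc₀', hFrob, hhP, hhK, h1, h2, h3, h4⟩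

end PrescribedPrimeN

/-! ## §N″  ANTI-LOSSLESS AT THE GALOIS LEVEL (PROVED): `ker(h₀ + 1) = im(h₀ - 1)` on every `E[m][2^k]`

§J proves `Ĥ⁰(⟨h⟩, E[2^M]) = 0` (lossless) AND `Ĥ⁻¹ = 0` (anti-lossless, v13) for the MATRIX `reg b`; §K exports only the lossless
clause for the Galois element `h₀ = c₀ · res ρ`.  Rather than re-thread a fifth clause through §J → §H → §K, the anti-lossless clause is
derived here from the exported ones by the finite counting identity `|im(A+1)|·|ker(A+1)| = |T| = |im(A-1)|·|ker(A-1)|` — so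
`(ε = -1)`-eigen-consumers (McCallum's `τ = -1` part) get their clause from §K's output with no change to the quarry. -/

section AntiLosslessN

variable (W : WeierstrassCurve ℚ)

/-- **Anti-lossless from lossless (finite modules with involution).**  For an additive involution `A` of a finite abelian group,
`ker(A - 1) ⊆ im(A + 1)` implies `ker(A + 1) ⊆ im(A - 1)` (both cohomology groups of the cyclic group `⟨A⟩` vanish together:
`|im(A+1)|·|ker(A+1)| = |T| = |im(A-1)|·|ker(A-1)|`). -/
theorem antiLossless_of_lossless {T : Type*} [AddCommGroup T] [Finite T] (A : T →+ T) (hA : ∀ x, A (A x) = x)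
    (hloss : ∀ x, A x = x → ∃ y, x = y + A y) : ∀ x, A x = -x → ∃ y, x = y - A y := by
  set fp : T →+ T := A + AddMonoidHom.id T with hfp
  set fm : T →+ T := A - AddMonoidHom.id T with hfm
  have hfp_apply : ∀ y, fp y = A y + y := fun y ↦ rfl
  have hfm_apply : ∀ y, fm y = A y - y := fun y ↦ rfl
  -- `im fp = ker fm` (lossless + `(A-1)(A+1) = 0`) and `im fm ≤ ker fp`
  have h1 : fp.range = fm.ker := by
    apply le_antisymm
    · rintro _ ⟨y, rfl⟩
      rw [AddMonoidHom.mem_ker, hfm_apply, hfp_apply, map_add, hA]; abel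
    · intro x hx
      rw [AddMonoidHom.mem_ker, hfm_apply, sub_eq_zero] at hx
      obtain ⟨y, hy⟩ := hloss x hx
      exact ⟨y, by rw [hfp_apply, hy, add_comm]⟩
  have h2 : fm.range ≤ fp.ker := by
    rintro _ ⟨y, rfl⟩
    rw [AddMonoidHom.mem_ker, hfp_apply, hfm_apply, map_sub, hA]; abel
  -- cardinalities
  have hcp : Nat.card T = Nat.card fp.range * Nat.card fp.ker := by
    rw [AddSubgroup.card_eq_card_quotient_mul_card_addSubgroup fp.ker,
      Nat.card_congr (QuotientAddGroup.quotientKerEquivRange fp).toEquiv]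
  have hcm : Nat.card T = Nat.card fm.range * Nat.card fm.ker := by
    rw [AddSubgroup.card_eq_card_quotient_mul_card_addSubgroup fm.ker,
      Nat.card_congr (QuotientAddGroup.quotientKerEquivRange fm).toEquiv]
  have hpos : 0 < Nat.card fm.ker := Nat.card_pos
  have hcard : Nat.card fp.ker ≤ Nat.card fm.range := by
    rw [h1] at hcp
    have : Nat.card fm.range * Nat.card fm.ker = Nat.card fp.ker * Nat.card fm.ker := by rw [← hcm, hcp, mul_comm]
    exact (Nat.eq_of_mul_eq_mul_right hpos this).ge
  have h3 : fm.range = fp.ker := AddSubgroup.eq_of_le_of_card_ge h2 hcard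
  intro x hx
  have hx' : x ∈ fp.ker := by rw [AddMonoidHom.mem_ker, hfp_apply, hx, neg_add_cancel]
  rw [← h3] at hx'
  obtain ⟨y, hy⟩ := hx'
  refine ⟨-y, ?_⟩
  rw [map_neg, ← hy, hfm_apply]; abel


/-- **Galois-level anti-lossless** (export for §K consumers): for `h₀ ∈ Γ_ℚ` acting as an involution on `E[m]` with the graded LOSSLESS clause
of §J/§K (`ker(h₀ - 1) = im(h₀ + 1)` on each `E[m][2^k]`), the graded ANTI-LOSSLESS clause holds: `ker(h₀ + 1) = im(h₀ - 1)` on each `E[m][2^k]`. -/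
theorem antiLossless_geomTorsion [W.IsElliptic] {m : ℕ} [NeZero m] (h₀ : absoluteGaloisGroup ℚ)
    (hsq : ∀ P : geomTorsion W (m : ℤ), h₀ • h₀ • P = P)
    (hker : ∀ (k : ℕ) (X : geomTorsion W (m : ℤ)), (2 : ℤ) ^ k • X = 0 → h₀ • X = X →
      ∃ Y : geomTorsion W (m : ℤ), (2 : ℤ) ^ k • Y = 0 ∧ X = Y + h₀ • Y)
    (k : ℕ) (X : geomTorsion W (m : ℤ)) (hk : (2 : ℤ) ^ k • X = 0) (hX : h₀ • X = -X) :
    ∃ Y : geomTorsion W (m : ℤ), (2 : ℤ) ^ k • Y = 0 ∧ X = Y - h₀ • Y := by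
  have hm : ((m : ℕ) : ℤ) ≠ 0 := by exact_mod_cast NeZero.ne m
  haveI : Finite (geomTorsion W (m : ℤ)) := finite_torsionPoints_holds W (AlgebraicClosure ℚ) hm
  -- the `2^k`-torsion subgroup `T_k ⊆ E[m]` and the restriction of `h₀` to it
  let Tk : AddSubgroup (geomTorsion W (m : ℤ)) := (zsmulAddGroupHom ((2 : ℤ) ^ k) : _ →+ _).ker
  have hmemTk : ∀ {Z : geomTorsion W (m : ℤ)}, Z ∈ Tk ↔ (2 : ℤ) ^ k • Z = 0 := fun {Z} ↦ by
    simp [Tk, AddMonoidHom.mem_ker]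
  let φ : geomTorsion W (m : ℤ) →+ geomTorsion W (m : ℤ) := DistribSMul.toAddMonoidHom _ h₀
  have hφ : ∀ Z, φ Z = h₀ • Z := fun Z ↦ rfl
  have hφTk : ∀ Z : Tk, φ Z ∈ Tk := fun Z ↦ by
    rw [hmemTk, hφ, smul_comm, hmemTk.1 Z.2, smul_zero]
  let A : Tk →+ Tk := (φ.comp Tk.subtype).codRestrict Tk (fun Z ↦ hφTk Z)
  have hA_apply : ∀ Z : Tk, ((A Z : Tk) : geomTorsion W (m : ℤ)) = h₀ • (Z : geomTorsion W (m : ℤ)) := fun Z ↦ rfl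
  have hA : ∀ Z, A (A Z) = Z := fun Z ↦ by
    apply Subtype.ext
    rw [hA_apply, hA_apply, hsq]
  have hloss : ∀ Z, A Z = Z → ∃ Y, Z = Y + A Y := by
    intro Z hZ
    have hZ' : h₀ • (Z : geomTorsion W (m : ℤ)) = Z := by rw [← hA_apply, hZ]
    obtain ⟨Y, hY, hZY⟩ := hker k Z (hmemTk.1 Z.2) hZ'
    refine ⟨⟨Y, hmemTk.2 hY⟩, Subtype.ext ?_⟩
    simpa [hA_apply] using hZY
  obtain ⟨Y, hY⟩ := antiLossless_of_lossless A hA hloss ⟨X, hmemTk.2 hk⟩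
    (Subtype.ext (by rw [hA_apply]; simpa using hX))
  refine ⟨Y, hmemTk.1 Y.2, ?_⟩
  have := congrArg (fun Z : Tk ↦ (Z : geomTorsion W (m : ℤ))) hY
  simpa [hA_apply] using this

end AntiLosslessN

end Summit.BirchSwinnertonDyer.BirchSwinnertonDyer.Theorems.OffBigImageOddLocalAtTwo.Engine

end
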